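import Mathlib
import Literature.MathematicalPhysics.QuantumFieldTheory.MagnenRivasseauSeneor1993.MRS93StartingAnsatz
import HarnessLib

/-!
# Magnen–Rivasseau–Sénéor, *Construction of YM₄ with an infrared cutoff* (CMP 155, 1993), Appendix 1 (A.5): the constants «8»,
# «6/2», «1/(8η)» of its last line ARE the radial-length integrals of `4κ`, `6κ`, `κ/4` over the three regions `{κ > 1/2}`,
# `{κ < 1/2}`, `{κ = 1/2}` of the stabilizing cutoff (II.14) — kernel-checked against the tree's `Ansatz.cutoffFn`

statement-level skeleton of published theorems with citation tags; proofs where landed; nothing here is a claim about the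
Yang–Mills mass gap, about continuum YM₄ on T⁴, or about the Clay problem

**Citation header (reproduction of PUBLISHED work).** J. Magnen, V. Rivasseau, R. Sénéor, *Construction of YM₄ with an infrared
cutoff*, Commun. Math. Phys. **155** (1993) 325–383 [MagnenRivasseauSeneor1993], Appendix 1 (A.5) p.379 [PDF 55] and (II.14) p.331
[PDF 7] (Fig. II.1). Display (A.5) read on the render `run/shared/lean/pub/pub-balaban-gaps/pub-balaban-gaps-mrs-lit-2/g3/renders/p55_crop_r2800-5600_s3.png`
(1/3 scale of the 600-dpi page image; the 1/6-scale `p55_full_s6.png` of `run/shared/lean/pub/lit-balaban/inprint/lit-balaban-p14/renders-cmp155/`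
shows the same). Cell pub-balaban-gaps (YM blitz, track G3), seat mrs-lit-2 (gen 3); companion record
`run/shared/lean/pub/pub-balaban-gaps/g3/MRS-AS-PRINTED-estimates.md` §3(i). Sibling files: `MRS93AppendixWarmUp.lean` ((A.1)–(A.5):
the integral (A.3), the closed form (A.4), the pointwise inequalities of (A.5) and its last-line implication `A5_lastLine_le_one`),
`MRS93StartingAnsatz.lean` (imported: the profile class `Ansatz.CutoffProfile` and the cutoff `Ansatz.cutoffFn` of (II.14) with its region
lemmas). Nothing of either is restated.

**What the paper prints (verbatim, from the page image).** (A.5) p.379, second and third lines: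
«`≤ exp∫_Δ(x⁴(−c + 9/2 + ∫_{κ>1/2} 4βv dv + ∫_{κ<1/2} 6βv dv − ∫_{κ=1/2} (βv/4) dv))`
 `≤ exp∫_Δ(x⁴(−c + 9/2) + x²M^{2k}(8 + 6/2 − (1/8η))) ≤ 1` (A.5)
if we take the parameter η in (II.14) sufficiently small, so that the constant c (which diverges like |log η|) is bigger than 9/2 and
such that η is smaller than 1/88; of course in (A.5) we assumed a cutoff with the particular shape of Fig. II.1.» — with «βv = κ»
(p.379 tl.17) the three integrands are `4κ`, `6κ`, `κ/4`. (II.14) p.331: «κ(p) ≡ 1 if |p| ≤ 1, κ(p) ≡ (1 + τ(|p|))/2 if 1 < |p| ≤ 2,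
κ(p) ≡ 1/2 if 2 < |p| ≤ 2 + η⁻¹, κ(p) ≡ (1/2)τ(|p| − 1 − η⁻¹) if 2 + η⁻¹ < |p|, (II.14)» (`τ` monotone decreasing, `= 1` on `x ≤ 1`,
`= 0` on `x ≥ 2`), so `{κ > 1/2} = [0, 2)`, `{κ = 1/2} = [2, 2 + η⁻¹]`, `{0 < κ < 1/2} ⊆ (2 + η⁻¹, 3 + η⁻¹)`, `κ = 0` from `3 + η⁻¹` on.

**What is PROVED here (zero `sorry`, zero named facts, no new definition).** For every profile `P : Ansatz.CutoffProfile` and every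
`η > 0`, with `κ = Ansatz.cutoffFn P η` as a function of the radial variable `r = |p|` of (II.14):
* `A5_plateau_integral` — `∫_2^{2+η⁻¹} (κ/4) dr = 1/(8η)` EXACTLY (the plateau `κ ≡ 1/2` of length `η⁻¹`): the «1/8η»;
* `A5_core_integral_le` — `∫_0^2 4κ dr ≤ 8` (`κ ≤ 1`): the «8» (the exact value is `6 + 2∫_1^2 τ ∈ [6, 8]`, `A5_core_integral_eq`);
* `A5_tail_integral_le` — `∫_{2+η⁻¹}^{3+η⁻¹} 6κ dr ≤ 6/2` (`κ ≤ 1/2` there) and `A5_beyond_integral_eq_zero` — `∫_{3+η⁻¹}^{R} 6κ dr = 0` for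
  `R ≥ 3 + η⁻¹` (`κ ≡ 0`): the «6/2»;
* `A5_bracket_le` — hence, for any `R ≥ 3 + η⁻¹`, the radial account of the second line's three integrals is
  `∫_0^2 4κ + ∫_{2+η⁻¹}^{R} 6κ − ∫_2^{2+η⁻¹} κ/4 ≤ 8 + 6/2 − 1/(8η)`, the bracket of the third line (which is `≤ 0` iff `η ≤ 1/88`,
  `AppendixOne.A5_eta_iff` in the sibling file).

**Reading (declared) — what this does and does not certify.** The identification is EXACT for the radial Lebesgue measure `dr`
(`r = |p|` in the units of (II.14)): the printed constants are the `dr`-integrals of the profile over its three regions. The second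
line of (A.5), however, integrates against `v dv` (`v = p²/x²`, p.372), i.e. against a measure `∝ r³ dr`, and converts `x⁴∫ … v dv` into
`x²M^{2k}( … )`; under `r³ dr` the plateau term grows like `η⁻⁴` and the tail term like `η⁻³` (not `η⁻¹` and `O(1)`), so the
conclusion «≤ 1 for η small enough» persists with a threshold of the same order, but the displayed `8 + 6/2 − 1/(8η)` is the
radial-LENGTH account. This file records that account as what the print's numbers are; it does not derive (A.5)'s third line from
its second (companion record §3(i)).

**What is NOT claimed.** (A.5) as a bound on the dressing factor; the change of variables `u ↦ v ↦ r`; Lemma VI.1. Nothing here bears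
on Bałaban's papers; nothing is continuum YM₄ on T⁴, nothing lifts the infrared cutoff, nothing is Clay.
-/

noncomputable section

open Real MeasureTheory Set intervalIntegral

namespace Literature.MathematicalPhysics.QuantumFieldTheory.MagnenRivasseauSeneor1993

namespace AppendixOne

open Ansatz

variable (P : CutoffProfile) {η : ℝ}

/-- The cutoff (II.14) is interval-integrable on every `[a, b]` (it is monotone decreasing for `η > 0`, `Ansatz.cutoffFn_antitone`).
[cite: MagnenRivasseauSeneor1993, (II.14) p.331] -/
theorem cutoffFn_intervalIntegrable (hη : 0 < η) (a b : ℝ) :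
    IntervalIntegrable (cutoffFn P η) volume a b :=
  ((cutoffFn_antitone P η hη).antitoneOn _).intervalIntegrable

/-- **The «1/8η» of (A.5)**: on the plateau `[2, 2 + η⁻¹]` of (II.14) `κ ≡ 1/2`, so `∫_2^{2+η⁻¹} (κ/4) dr = (1/2)(1/4)η⁻¹ = 1/(8η)`
(`η > 0`). [cite: MagnenRivasseauSeneor1993, App. 1 (A.5) p.379; (II.14) p.331] -/
theorem A5_plateau_integral (hη : 0 < η) :
    ∫ r in (2 : ℝ)..(2 + η⁻¹), cutoffFn P η r / 4 = 1 / (8 * η) := by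
  have hη' : 0 < η⁻¹ := inv_pos.mpr hη
  have hcongr : ∫ r in (2 : ℝ)..(2 + η⁻¹), cutoffFn P η r / 4 = ∫ r in (2 : ℝ)..(2 + η⁻¹), (1 / 8 : ℝ) := by
    refine intervalIntegral.integral_congr (fun r hr => ?_)
    rw [uIcc_of_le (by linarith)] at hr
    rcases eq_or_lt_of_le hr.1 with h2 | h2
    · rw [← h2, cutoffFn_two]; norm_num
    · rw [cutoffFn_plateau P η h2 hr.2]; norm_num
  rw [hcongr, intervalIntegral.integral_const]
  simp only [smul_eq_mul]
  field_simp
  ring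

/-- **The «8» of (A.5)**: `∫_0^2 4κ dr ≤ 8` since `κ ≤ 1` (`{κ > 1/2} = [0, 2)` for (II.14)).
[cite: MagnenRivasseauSeneor1993, App. 1 (A.5) p.379; (II.14) p.331] -/
theorem A5_core_integral_le (hη : 0 < η) :
    ∫ r in (0 : ℝ)..2, 4 * cutoffFn P η r ≤ 8 := by
  have hmono : ∫ r in (0 : ℝ)..2, 4 * cutoffFn P η r ≤ ∫ r in (0 : ℝ)..2, (4 : ℝ) := by
    refine intervalIntegral.integral_mono_on (by norm_num)
      ((cutoffFn_intervalIntegrable P hη 0 2).const_mul 4) intervalIntegrable_const (fun r _ => ?_)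
    linarith [cutoffFn_le_one P η r]
  rw [intervalIntegral.integral_const] at hmono
  have h8 : ((2 : ℝ) - 0) • (4 : ℝ) = 8 := by norm_num
  linarith

/-- The exact value behind the «8»: `∫_0^2 4κ dr = 6 + 2∫_1^2 τ` (`κ = 1` on `[0, 1]`, `(1 + τ)/2` on `(1, 2]`), a number in `[6, 8]`.
[cite: MagnenRivasseauSeneor1993, App. 1 (A.5) p.379; (II.14) p.331] -/
theorem A5_core_integral_eq (hη : 0 < η) :
    ∫ r in (0 : ℝ)..2, 4 * cutoffFn P η r = 6 + 2 * ∫ r in (1 : ℝ)..2, P.τ r := by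
  have hτint : IntervalIntegrable P.τ volume 1 2 := (P.antitone.antitoneOn _).intervalIntegrable
  rw [← intervalIntegral.integral_add_adjacent_intervals
    ((cutoffFn_intervalIntegrable P hη 0 1).const_mul 4) ((cutoffFn_intervalIntegrable P hη 1 2).const_mul 4)]
  have h1 : ∫ r in (0 : ℝ)..1, 4 * cutoffFn P η r = 4 := by
    have : ∫ r in (0 : ℝ)..1, 4 * cutoffFn P η r = ∫ r in (0 : ℝ)..1, (4 : ℝ) := by
      refine intervalIntegral.integral_congr (fun r hr => ?_)
      rw [uIcc_of_le zero_le_one] at hr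
      rw [cutoffFn_of_le_one P η hr.2]; norm_num
    rw [this, intervalIntegral.integral_const]; simp
  have h2 : ∫ r in (1 : ℝ)..2, 4 * cutoffFn P η r = ∫ r in (1 : ℝ)..2, (2 + 2 * P.τ r) := by
    refine intervalIntegral.integral_congr (fun r hr => ?_)
    rw [uIcc_of_le one_le_two] at hr
    rcases eq_or_lt_of_le hr.1 with h | h
    · rw [← h, (cutoffFn_one P η).1, P.τ_one]; norm_num
    · rw [cutoffFn_of_one_lt_of_le_two P η h hr.2]; ring
  rw [h1, h2, intervalIntegral.integral_add intervalIntegrable_const (hτint.const_mul 2),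
    intervalIntegral.integral_const, intervalIntegral.integral_const_mul]
  simp
  ring

/-- **The «6/2» of (A.5)**: on the tail `(2 + η⁻¹, 3 + η⁻¹]` of (II.14) `κ ≤ 1/2`, so `∫_{2+η⁻¹}^{3+η⁻¹} 6κ dr ≤ 6/2`.
[cite: MagnenRivasseauSeneor1993, App. 1 (A.5) p.379; (II.14) p.331] -/
theorem A5_tail_integral_le (hη : 0 < η) :
    ∫ r in (2 + η⁻¹ : ℝ)..(3 + η⁻¹), 6 * cutoffFn P η r ≤ 6 / 2 := by
  have hmono : ∫ r in (2 + η⁻¹ : ℝ)..(3 + η⁻¹), 6 * cutoffFn P η r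
      ≤ ∫ r in (2 + η⁻¹ : ℝ)..(3 + η⁻¹), (3 : ℝ) := by
    refine intervalIntegral.integral_mono_on (by linarith)
      ((cutoffFn_intervalIntegrable P hη _ _).const_mul 6) intervalIntegrable_const (fun r hr => ?_)
    have hη' : 0 < η⁻¹ := inv_pos.mpr hη
    have := cutoffFn_le_half_of_two_lt P η hη (show 2 < r by linarith [hr.1])
    linarith
  rw [intervalIntegral.integral_const] at hmono
  simp only [smul_eq_mul] at hmono
  linarith

/-- Beyond `3 + η⁻¹` the cutoff vanishes, so the rest of `{κ < 1/2}` contributes nothing: `∫_{3+η⁻¹}^{R} 6κ dr = 0` (`R ≥ 3 + η⁻¹`).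
[cite: MagnenRivasseauSeneor1993, (II.14) and Fig. II.1 p.331] -/
theorem A5_beyond_integral_eq_zero (hη : 0 < η) {R : ℝ} (hR : 3 + η⁻¹ ≤ R) :
    ∫ r in (3 + η⁻¹ : ℝ)..R, 6 * cutoffFn P η r = 0 := by
  have : ∫ r in (3 + η⁻¹ : ℝ)..R, 6 * cutoffFn P η r = ∫ r in (3 + η⁻¹ : ℝ)..R, (0 : ℝ) := by
    refine intervalIntegral.integral_congr (fun r hr => ?_)
    rw [uIcc_of_le hR] at hr
    rw [cutoffFn_eq_zero_of_le P η hη hr.1, mul_zero]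
  rw [this, intervalIntegral.integral_const]; simp

/-- **(A.5), second line → third line, as a radial-length account**: for the profile (II.14), any `η > 0` and any `R ≥ 3 + η⁻¹`,
`∫_0^2 4κ dr + ∫_{2+η⁻¹}^{R} 6κ dr − ∫_2^{2+η⁻¹} (κ/4) dr ≤ 8 + 6/2 − 1/(8η)` — the bracket printed against `x²M^{2k}` (negative iff
`η ≤ 1/88`). Reading declared in the module docstring: (A.5) integrates against `v dv`, not `dr`; this is the account that produces the
printed numbers. [cite: MagnenRivasseauSeneor1993, App. 1 (A.5) p.379; (II.14) p.331] -/
theorem A5_bracket_le (hη : 0 < η) {R : ℝ} (hR : 3 + η⁻¹ ≤ R) :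
    (∫ r in (0 : ℝ)..2, 4 * cutoffFn P η r) + (∫ r in (2 + η⁻¹ : ℝ)..R, 6 * cutoffFn P η r)
      - (∫ r in (2 : ℝ)..(2 + η⁻¹), cutoffFn P η r / 4) ≤ 8 + 6 / 2 - 1 / (8 * η) := by
  rw [← intervalIntegral.integral_add_adjacent_intervals
      ((cutoffFn_intervalIntegrable P hη (2 + η⁻¹) (3 + η⁻¹)).const_mul 6)
      ((cutoffFn_intervalIntegrable P hη (3 + η⁻¹) R).const_mul 6),
    A5_beyond_integral_eq_zero P hη hR, add_zero, A5_plateau_integral P hη]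
  have h1 := A5_core_integral_le P hη
  have h2 := A5_tail_integral_le P hη
  linarith

end AppendixOne

end Literature.MathematicalPhysics.QuantumFieldTheory.MagnenRivasseauSeneor1993
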